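import Summits.SmoothPoincare4.SmoothPoincare4.Theses.SymplecticOrigami
import Summits.SmoothPoincare4.SmoothPoincare4.Theorems.SymplecticOrigamiNoGenusTwoDoorStubTaubesCanonicalCurveDoorLattice

/-!
# Strategist census r1 — typed signatures (crux stmt-SmoothPoincare4-7842 `NoGenusTwoDoor`)

Companion of the r1 part of `STRATEGY-CENSUS.md` (REDIRECT strategist r1, second opinion,
`planner-cstrat-stmt-SmoothPoincare4-7842-r1-0`, 2026-08-17).  It TYPES, over existing declarations,
the new objects of the r1 census so that "as a signature" is literal, exactly as the p1 companion
`StrategistCensus.lean` did for the first census: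

* `## Strengthen` (r1): `TwoAsphericalEulerNonneg` (S⁺_sa) — "a closed symplectic 4-manifold all of
  whose rational `H₂` is aspherical (`f_* = 0` on `H₂(·; ℚ)` for every `f : S² → N`) has `χ ≥ 0`",
  the symplectic shadow of Gromov's Kähler-hyperbolicity theorem / the 4-dimensional Hopf–Singer
  sign conjecture; it implies the aspherical half of the crux
  (`subAsphericalDoor_of_twoAsphericalEulerNonneg`).  OPEN; the census explains why the only engine
  (`L²`-Hodge theory + the Kähler identity `d(Jθ) = 0`) does not transfer to almost-Kähler metrics.
* `## Decomposition` (r1): the split of the crux by SPHERICITY of the generator `h` of `H₂(N)/Tors`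
  — `SubAsphericalDoor` (rational Hurewicz map zero: `[ω] ∝ h` is aspherical, `ω̃` exact on the
  universal cover, `b₂(π₁ N) = 1`) and `SubSphericalDoor` (some sphere is rationally essential:
  `b₂(π₁ N) = 0`, the case containing the `F₂`-like door of the p1 census) — with the glue
  `noGenusTwoDoor_of_sphericitySplit` PROVED (excluded middle; trivial seam) and both pieces
  certified to be special cases of the crux (`…_of_noGenusTwoDoor`).  Not filed as a route split:
  neither piece has an input theorem (census r1 §R4).

* `## The standing of the crux` (r1, for the tribunal): `GompfEulerNonnegBPlusOne` — Gompf's 1995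
  `χ ≥ 0` question AT `b⁺ = 1` in numerical form ("closed symplectic, symplectic orientation with
  `b⁺ = 1` and `c₁² = 2χ + 3σ ≥ 0` ⇒ `χ ≥ 0`") — and the CONVERSE bridge
  `gompfEulerNonnegBPlusOne_of_noGenusTwoDoor : NoGenusTwoDoor → SymplecticBettiParity → …`,
  PROVED here from the tree's Poincaré duality / `b₂ = b⁺ + b⁻` / Euler-sum theorems.  Together
  with the landed forward bridge `stub_noGenusTwoDoor_of_gompfQuestionCalibrated` (p162069) this
  certifies in the kernel that the crux is EXACTLY the `b⁺ = 1` case of the named open problem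
  (modulo the route's own parity support item), i.e. neither weaker nor stronger than it.

Nothing here is a registered line; no `stub_*`.  Sorry-free.
-/

noncomputable section

set_option linter.dupNamespace false

open scoped Manifold ContDiff Topology ContinuousMap
open Set Function TopologicalSpace
open Literature.Geometry.Kaehler (MForm IsSmoothForm IsClosedForm)
open Literature.AlgebraicTopology.SingularHomology
open Literature.Topology.FourManifolds (singularHomologyZ)
open Summit.SmoothPoincare4.SmoothPoincare4.Theses.SymplecticOrigami (NoGenusTwoDoor SymplecticBettiParity)
open Summit.SmoothPoincare4.SmoothPoincare4.Theorems.NoGenusTwoDoor.CanonicalCapFilling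
  (finrank_singularHomology_three_eq_finrank_one)

namespace Summit.SmoothPoincare4.SmoothPoincare4.Cruxes.NoGenusTwoDoor.StrategistCensusR1

/-- Model space `ℝⁿ`. -/
local notation "𝔼" n:arg => EuclideanSpace ℝ (Fin n)

/-- The round `2`-sphere `S² ⊂ ℝ³`. -/
local notation "𝕊²" => (Metric.sphere (0 : EuclideanSpace ℝ (Fin 3)) 1)

/-! ## The sphericity predicate -/

/-- **Rational `H₂`-asphericity**: every continuous `f : S² → N` induces the zero map on
`H₂(·; ℚ)`, i.e. the rational Hurewicz map `π₂(N) ⊗ ℚ → H₂(N; ℚ)` vanishes (Hopf: equivalently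
`H₂(N; ℚ) → H₂(π₁ N; ℚ)` is injective).  For a door (`H₂(N; ℚ) = ℚh`, `[ω] = c·h`) this says the
symplectic class is aspherical, hence `ω` lifts to an EXACT form on the universal cover
("weakly symplectically aspherical", Kȩdra–Rudyak–Tralle). [cite: arXiv:0709.1799, §1] -/
def IsRationallyTwoAspherical (N : Type) [TopologicalSpace N] : Prop :=
  ∀ f : C(𝕊², N), singularHomology.map ℚ ℚ f 2 = 0

/-! ## Strengthening S⁺_sa (census r1 `## Strengthen`) -/

/-- **S⁺_sa — Euler non-negativity for rationally `H₂`-aspherical closed symplectic 4-manifolds:**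
`χ = 2 − 2b₁ + b₂ ≥ 0`, written `2b₁ ≤ 2 + b₂`.  Contains the 4-dimensional Hopf/Singer sign
conjecture for ASPHERICAL symplectic 4-manifolds and the aspherical half of Gompf's `χ ≥ 0`
question; known for Kähler surfaces (classification: `c₂ ≥ 0` off the ruled class, and ruled
surfaces over `Σ_g`, `g ≥ 1`, have essential spheres) and for Kähler-hyperbolic manifolds (Gromov
1991, `L²`-Lefschetz).  OPEN symplectically: the `L²`-Lefschetz step `H¹₍₂₎ → H³₍₂₎`, `θ ↦ ω̃ ∧ θ`,
needs `d(Jθ) = 0` for `L²`-harmonic 1-forms, the Kähler identity (census r1 §R2 (T-L²)).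
[cite: doi:10.4310/jdg/1214446039, Thm. 0.4.A and §1.2] [cite: arXiv:0711.3828, §1 (History)] -/
def TwoAsphericalEulerNonneg : Prop :=
  ∀ (N : Type) [TopologicalSpace N] [T2Space N] [SecondCountableTopology N] [CompactSpace N]
    [ConnectedSpace N] [ChartedSpace (𝔼 4) N] [IsManifold (𝓡 4) ∞ N] (s : MForm (𝓡 4) N ℝ 2),
    IsSmoothForm s → IsClosedForm s →
    (∀ x (v : TangentSpace (𝓡 4) x), v ≠ 0 → ∃ w, s x ![v, w] ≠ 0) →
    IsRationallyTwoAspherical N →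
    2 * Module.finrank ℤ (singularHomologyZ N 1) ≤ 2 + Module.finrank ℤ (singularHomologyZ N 2)

/-! ## Decomposition by sphericity of `h` (census r1 `## Decomposition`, (D-asp)) -/

/-- **Sub-crux A (aspherical `h`)**: no door whose rational `H₂` is aspherical (equivalently, for a
door, `b₂(π₁ N) = 1`; `ω̃ = dλ` on the universal cover; every closed symplectic surface in `N`,
in particular the Taubes curve, has infinite `π₁`-image). -/
def SubAsphericalDoor : Prop :=
  ∀ (N : Type) [TopologicalSpace N] [T2Space N] [SecondCountableTopology N] [CompactSpace N]
    [ConnectedSpace N] [ChartedSpace (𝔼 4) N] [IsManifold (𝓡 4) ∞ N] (s : MForm (𝓡 4) N ℝ 2),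
    IsSmoothForm s → IsClosedForm s →
    (∀ x (v : TangentSpace (𝓡 4) x), v ≠ 0 → ∃ w, s x ![v, w] ≠ 0) →
    IsRationallyTwoAspherical N →
    ¬ (Module.finrank ℤ (singularHomologyZ N 1) = 2 ∧ Module.finrank ℤ (singularHomologyZ N 2) = 1)

/-- **Sub-crux B (spherical `h`)**: no door with a rationally essential 2-sphere (equivalently
`b₂(π₁ N) = 0`: some multiple of `h`, hence a class of positive symplectic area and square `m²`,
is represented by a map `S² → N`; contains every door with free, or merely `H₂(·;ℚ)`-acyclic,
fundamental group — the `F₂`-like kernel of the p1 census). -/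
def SubSphericalDoor : Prop :=
  ∀ (N : Type) [TopologicalSpace N] [T2Space N] [SecondCountableTopology N] [CompactSpace N]
    [ConnectedSpace N] [ChartedSpace (𝔼 4) N] [IsManifold (𝓡 4) ∞ N] (s : MForm (𝓡 4) N ℝ 2),
    IsSmoothForm s → IsClosedForm s →
    (∀ x (v : TangentSpace (𝓡 4) x), v ≠ 0 → ∃ w, s x ![v, w] ≠ 0) →
    (∃ f : C(𝕊², N), singularHomology.map ℚ ℚ f 2 ≠ 0) →
    ¬ (Module.finrank ℤ (singularHomologyZ N 1) = 2 ∧ Module.finrank ℤ (singularHomologyZ N 2) = 1)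

/-- **Glue of the sphericity split (PROVED, excluded middle — a trivial seam):**
`SubAsphericalDoor → SubSphericalDoor → NoGenusTwoDoor`. -/
theorem noGenusTwoDoor_of_sphericitySplit (hA : SubAsphericalDoor) (hB : SubSphericalDoor) :
    NoGenusTwoDoor := by
  intro N _ _ _ _ _ _ _ s hs hcl hnd hdoor
  by_cases h : IsRationallyTwoAspherical N
  · exact hA N s hs hcl hnd h hdoor
  · have h' : ∃ f : C(𝕊², N), singularHomology.map ℚ ℚ f 2 ≠ 0 := by
      by_contra hne
      exact h fun f ↦ by_contra fun hf ↦ hne ⟨f, hf⟩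
    exact hB N s hs hcl hnd h' hdoor

/-- Piece A is a special case of the crux (so the split is honest: A is not the crux reworded with
an idle hypothesis only if `IsRationallyTwoAspherical` can fail on a door — it can: a door with
free `π₁` is in piece B). -/
theorem subAsphericalDoor_of_noGenusTwoDoor (h : NoGenusTwoDoor) : SubAsphericalDoor :=
  fun N _ _ _ _ _ _ _ s hs hcl hnd _ ↦ h N s hs hcl hnd

/-- Piece B is a special case of the crux. -/
theorem subSphericalDoor_of_noGenusTwoDoor (h : NoGenusTwoDoor) : SubSphericalDoor :=
  fun N _ _ _ _ _ _ _ s hs hcl hnd _ ↦ h N s hs hcl hnd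

/-- S⁺_sa ⇒ piece A: an aspherical door would have `2·2 ≤ 2 + 1`. -/
theorem subAsphericalDoor_of_twoAsphericalEulerNonneg (h : TwoAsphericalEulerNonneg) :
    SubAsphericalDoor := by
  intro N _ _ _ _ _ _ _ s hs hcl hnd hasp hdoor
  have := h N s hs hcl hnd hasp
  omega

/-! ## The standing of the crux: it is exactly Gompf's question at `b⁺ = 1` -/

/-- **Gompf's `χ ≥ 0` question at `b⁺ = 1`, numerical form.**  For a closed connected symplectic
`(N, s)` with its symplectic homological orientation `μ`: if `b⁺(μ) = 1` and
`2χ(N) + 3σ(N, μ) ≥ 0` (= `c₁² ≥ 0` by Hirzebruch; at `b⁺ = 1` this is Liu's characterisation of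
"minimal and neither rational-with-`χ < 3` nor irrational ruled", and it also admits the rational
surfaces `ℂP² # k ℂP²bar`, `k ≤ 9`, which have `χ ≥ 3` anyway), then `χ(N) ≥ 0`.  This is the
printed smallest open case of Gompf's question (Kotschick 2006; T.-J. Li 2015 §4.3.1: a
counterexample is exactly a door). [cite: doi:10.1090/s0002-9939-06-08352-3, last paragraph]
[cite: arXiv:1511.04831, §4.3.1] -/
def GompfEulerNonnegBPlusOne : Prop :=
  ∀ (N : Type) [TopologicalSpace N] [T2Space N] [SecondCountableTopology N] [CompactSpace N]
    [ConnectedSpace N] [ChartedSpace (𝔼 4) N] [IsManifold (𝓡 4) ∞ N] (s : MForm (𝓡 4) N ℝ 2)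
    (hs : IsSmoothForm s) (hcl : IsClosedForm s),
    (∀ x (v : TangentSpace (𝓡 4) x), v ≠ 0 → ∃ w, s x ![v, w] ≠ 0) →
    ∀ μ : HomologicalOrientation ℤ N 4, μ.IsSymplecticOrientationOf s hs hcl →
      sigPos (intersectionForm two_add_two_eq_four μ).toQuadraticMap = 1 →
      0 ≤ 2 * relEuler ℤ ℤ N ∅ + 3 * μ.signature →
      0 ≤ relEuler ℤ ℤ N ∅

/-- **Converse bridge (PROVED): the crux implies Gompf's question at `b⁺ = 1`**, modulo exactly the
route's own support item `SymplecticBettiParity` (`1 + b₁ + b⁺` even; McDuff–Salamon 2017 §13.3).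
Bookkeeping: `b₂ = b⁺ + b⁻ = 1 + b⁻`, `χ = 2 − 2b₁ + b₂`, `σ = 1 − b⁻`, so
`0 ≤ 2χ + 3σ = 9 − 4b₁ − b⁻` forces `b₁ ≤ 2`; parity makes `b₁ ∈ {0, 2}`; `b₁ = 0` gives `χ ≥ 3`,
`b₁ = 2` gives `b⁻ ≤ 1` and `χ = b⁻ − 1`, negative only for `b⁻ = 0`, i.e. for a door.  With the
landed forward bridge `stub_noGenusTwoDoor_of_gompfQuestionCalibrated` (p162069) the crux is thus
kernel-certified to be EXACTLY the `b⁺ = 1` case of Gompf's 1995 question.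
[cite: McDuffSalamon2017, §13.3 p. 527] [cite: doi:10.1090/s0002-9939-06-08352-3, last paragraph] -/
theorem gompfEulerNonnegBPlusOne_of_noGenusTwoDoor (hD : NoGenusTwoDoor)
    (hP : SymplecticBettiParity) : GompfEulerNonnegBPlusOne := by
  intro N _ _ _ _ _ _ _ s hs hcl hnd μ hμ hbp hK
  -- parity: `1 + b₁ + b⁺` even with `b⁺ = 1`
  have hpar : Even (1 + Module.finrank ℤ (singularHomology ℤ ℤ N 1) + 1) := by
    have h := hP N s hs hcl hnd μ hμ
    rwa [hbp] at h
  -- `b₂ = b⁺ + b⁻ = 1 + b⁻`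
  have hsum : Module.finrank ℤ (singularHomology ℤ ℤ N 2) =
      1 + sigNeg (intersectionForm two_add_two_eq_four μ).toQuadraticMap := by
    have h := Literature.Topology.FourManifolds.finrank_eq_sigPos_add_sigNeg_intersectionForm_holds
      (X := N) (k := 2) (n := 4) even_two two_add_two_eq_four μ
    have hf := finrank_freeCohomology_eq_bettiNumber_holds (X := N) (n := 4) 2
    unfold finrank_freeCohomology_eq_bettiNumber at hf
    rw [hf, ← bettiNumber_int_eq_rat, hbp] at h
    exact h
  -- `χ = 2 − 2b₁ + b₂` (Poincaré duality `b₃ = b₁`, `b₀ = b₄ = 1`)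
  have hχ : relEuler ℤ ℤ N ∅ = 2 - 2 * (Module.finrank ℤ (singularHomology ℤ ℤ N 1) : ℤ)
      + (Module.finrank ℤ (singularHomology ℤ ℤ N 2) : ℤ) := by
    have h0 : Module.finrank ℤ (singularHomology ℤ ℤ N 0) = 1 :=
      Literature.Topology.FourManifolds.finrank_singularHomology_zero_eq_one_of_connected_four
    have h3 : Module.finrank ℤ (singularHomology ℤ ℤ N 3) =
        Module.finrank ℤ (singularHomology ℤ ℤ N 1) :=
      finrank_singularHomology_three_eq_finrank_one μ
    have h4 : Module.finrank ℤ (singularHomology ℤ ℤ N 4) = 1 :=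
      Literature.Topology.FourManifolds.finrank_singularHomology_four_eq_one μ
    rw [(Literature.Topology.FourManifolds.finRelHomology_of_compactSpace_four N).relEuler_empty_eq_sum]
    simp only [Finset.sum_range_succ, Finset.sum_range_zero, h0, h3, h4]
    push_cast
    ring
  -- `σ = b⁺ − b⁻ = 1 − b⁻`
  have hσ : μ.signature = 1 - (sigNeg (intersectionForm two_add_two_eq_four μ).toQuadraticMap : ℤ) := by
    simp only [HomologicalOrientation.signature, LinearMap.BilinForm.signature, hbp]
    push_cast
    ring
  -- no door
  have hnd' : ¬ (Module.finrank ℤ (singularHomology ℤ ℤ N 1) = 2 ∧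
      Module.finrank ℤ (singularHomology ℤ ℤ N 2) = 1) := hD N s hs hcl hnd
  rw [hχ, hσ] at hK
  rw [hχ]
  obtain ⟨k, hk⟩ := hpar
  omega

end Summit.SmoothPoincare4.SmoothPoincare4.Cruxes.NoGenusTwoDoor.StrategistCensusR1
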